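import Literature.MathematicalPhysics.QuantumFieldTheory.Balaban1983to89.B16RLeafRecord13Live
import Literature.MathematicalPhysics.QuantumFieldTheory.Balaban1983to89.Node00.Record13SepCoPHChi
import Literature.MathematicalPhysics.QuantumFieldTheory.Balaban1983to89.Node00.Record13ResidualsRChi

/-!
# χ-GENERIC RE-ISSUE (WORK ORDER RC-1 «RE-CENTRE THE RECORD», director-ym №462 (B) ∕ №467 (D)) of `B16RLeafRecord13Live`

Cell `pub-ymgap` (HUMAN RULING D-0062, Track A), seat `pub-ymgap-dag-n11-d` (N11 [B14] s2; N11-σ campaign, `N11-G44-RC1-REACH-CENSUS.md`).  The CENTRE-TYPED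
declarations of `B16RLeafRecord13Live` (those whose statement reads the (2.9) cut-off centre through `gOfRecord₁₃ ∕ EOfRecord₁₃ ∕ Provisos₁₃… ∕ T∕SLaw₁₃… ∕
UbgOfRecord₁₃… ∕ WtOfRecord₁₃… ∕ datum∕tower∕coreOfRecord₁₃…`) RE-ISSUED VERBATIM in the β-slot `χ : ChiSlot F N` over [Ax-3b]∕[Ax-3c]∕[Ax-3d]'s χ-generic carriers
(`Node00/Record13Chi` ∕ `Record13CoPHChi` ∕ `Record13SepCoPHChi`): σ = (binder `(χ : ChiSlot F N)` after `θ`; Node00 defs `X ↦ XChi … χ`; Node00 rows `Y ↦ Y_chi`;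
this lane's sibling modules `…Chi` for Summits-side dependencies); SAME short names in the sibling namespace `…B16RLeafRecord13LiveChi` (consumers switch by namespace);
the 36 centre-FREE declarations of the original are NOT copied — they are reused BY NAME (`open … (…)` below).  At `χ := chiβOfRecord₁₃ θ` every statement here is
DEFINITIONALLY the landed one ([Ax-3b]'s `rfl` receipts); at `χ := chiβOfRecord₁₃Ax θ` it is what the Ax-record's N11 machine reads.  Nothing of record edited (body-freeze №460 (2)).

HONEST FRAMING.  Count-neutral kernel re-elaboration of landed N11 bookkeeping∕estimates in a parameter; every HYPOTHESIS of the original stays a hypothesis; nothing of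
Bałaban asserted beyond what the original file proves; N11 NOT discharged; K-items untouched; counts unmoved.  One finite `𝕋⁴_{L^K}` programme at fixed `ε = L^{−K}` —
NOT ℝ⁴, NOT OS, NOT a mass gap, NOT Clay.  No `sorry`∕`instance`∕`notation`.  Sources: as the original module, plus [I] = [Balaban1987RG1] (2.9) p.266 (the cut-off's centre).
-/

noncomputable section

open MeasureTheory
open scoped BigOperators Matrix.Norms.L2Operator

namespace Literature.MathematicalPhysics.QuantumFieldTheory.Balaban1983to89.B16RLeafRecord13LiveChi

open Literature.MathematicalPhysics.QuantumFieldTheory.Balaban1983to89.B16RLeafRecord13Live (fibreIntegral_termT₁₃_eq_zero_of_slotsT_eq_zero fibreIntegral_termT₁₃_eq_zero_of_not_live slotsOfRecord₁₃_succ_ae_eq_slotsT_of_fix_of_dead sLaw₁₃_succ_of_tLaw₁₃_of_idem_of_dead rOpLeaf_VOfRecord₁₃_of_idem_of_dead laws₁₃_of_idem_of_dead rOperation_leavesP_of_idem_of_dead₁₃ sLaw₁₃_all_of_laws sLaw₁₃_all_of_thmP245_of_idem_of_dead sLaw₁₃_succ_of_tLawLive_of_idem_of_dead sLaw₁₃_all_of_thmP245Live_of_idem_of_dead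 densitiesDescribed_at_record₁₃_of_laws densitiesDescribed_at_record₁₃_of_idem_of_dead b14_main_at_record₁₃_of_rOpLeaf b14_main_at_record₁₃_of_idem_of_dead b14_main_of_isRecordOfRecord₁₃C_datum_of_idem_of_dead thm1Printed_datumOfRecord₁₃_of_laws_of_idem_of_dead inductionStep_datumOfRecord₁₃_of_tLawLive_of_idem_of_dead thm1Printed_datumOfRecord₁₃_of_lawsLive_of_idem_of_dead densOfRecord₁₃_succ_ae_eq_tdens_of_idem_of_dead slotsOfRecord₁₃_succ_eq_zero_of_not_liveSeq_of_liveSel rOpLeaf_VOfRecord₁₃_of_liveSel laws₁₃_of_liveSel rOperation_leavesP_of_liveSel₁₃ sLaw₁₃_succ_of_tLawLiveSeq_of_liveSel sLaw₁₃_all_of_thmP245LiveSeq_of_liveSel sLaw₁₃_all_of_thmP245_of_liveSel b14_main_at_record₁₃_of_liveSel b14_main_at_record₁₃_of_lawsLive_of_liveSel b14_main_of_isRecordOfRecord₁₃C_datum_of_liveSel thm1Printed_datumOfRecord₁₃_of_laws_of_liveSel thm1Printed_datumOfRecord₁₃_of_lawsLive_of_liveSel densOfRecord₁₃_succ_ae_eq_tdens_of_liveSel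 sLaw₁₃_succ_of_tLaw₁₃_of_absorbPresent rOpLeaf_VOfRecord₁₃_of_absorbPresent laws₁₃_of_absorbPresent)
open T4Continuum T4DatumAssembly Node00 B14.Eq218Concrete DagBinding
open B16RLeafRecord11 B16RLeafRecord12 B16RLeafRecord12Live B16RLeafRecord12AtLive
open B14NodeKnitTowerDatum (densitiesDescribed_iff_core b14_main_at_datumOfTower_of_propTower)

variable (F : T4Family) (N : ℕ) [NeZero N]

/-! ## §0  The sign `0 ≤ g_{k+1}` is free along every Stage-13 history -/

section FreeSign

/-- **EVERY GENERATED COUPLING OF POSITIVE LEVEL IS NON-NEGATIVE, Stage 13**: `gOfRecord₁₃ θ p (k+1) = genSeq β₁₃ g₀ (k+1) = solveCoupling (…) ≥ 0` (the (0.20)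
forward solution is `1∕√y` or `0`), whatever the β re-point. [cite: Balaban1987RG1, (0.17)–(0.20) pp.255–256 (bookkeeping)] -/
theorem gOfRecord₁₃_succ_nonneg (θ : Stage13Params F N) (χ : ChiSlot F N) (p : B12.RunParams) (k : ℕ) : 0 ≤ gOfRecord₁₃Chi F N θ χ p (k + 1) := by
  show 0 ≤ FlowStepRuns.genSeq _ _ (k + 1)
  rw [FlowStepRuns.genSeq_succ]
  exact solveCoupling_nonneg _

end FreeSign

/-! ## §1  DEAD SEQUENCES at the Stage-13 slot families: absent, dead, and the a.e. identity at fixed points under the integrable-form `rstep` -/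

section AtRecordSlots

variable (θ : Stage13Params F N) (χ : ChiSlot F N) (p : B12.RunParams)

/-- **OFF THE RANGE OF `θ.ppSel p g (k+1)` THE POST-𝐑 SLOT OF `ρ_{k+1}` VANISHES IDENTICALLY**, Stage 13 (`slotsOfRecord_succ` + n13-c's empty-fibre lemma).
[cite: Balaban1989LargeFieldI, (0.3) p.176; Balaban1988Convergent, (2.17)–(2.18) p.257] -/
theorem slotsOfRecord₁₃_succ_eq_zero_of_not_mem_range (k : ℕ)
    (s' : SeqOfRecord F θ.ν θ.τ9.M (gOfRecord₁₃Chi F N θ χ p) p.K (k + 1))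
    (hs' : s' ∉ Set.range (θ.ppSel p (gOfRecord₁₃Chi F N θ χ p) (k + 1))) :
    slotsOfRecord F N θ.ν θ.τ9 (EOfRecord₁₃Chi F N θ χ) (wOfRecord₉ F N θ.toStage9Params) θ.ppSel p (gOfRecord₁₃Chi F N θ χ p) (k + 1) s' = 0 := by
  funext V
  rw [slotsOfRecord_succ]
  exact rstepSlotOfRecord_of_not_mem_range θ.ν θ.τ9 θ.ppSel p _ (k + 1) _ s' hs' V

/-- **AN ABSENT 𝐓-SLOT GIVES AN ABSENT POST-𝐑 SLOT**, Stage 13. [cite: Balaban1989LargeFieldI, (0.3) p.176; Balaban1988Convergent, (3.24)–(3.25) p.270] -/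
theorem slotsOfRecord₁₃_succ_eq_zero_of_slotsT_eq_zero (k : ℕ)
    (s' : SeqOfRecord F θ.ν θ.τ9.M (gOfRecord₁₃Chi F N θ χ p) p.K (k + 1))
    (h0 : slotsTOfRecord F N θ.ν θ.τ9 (EOfRecord₁₃Chi F N θ χ) (wOfRecord₉ F N θ.toStage9Params) θ.ppSel p (gOfRecord₁₃Chi F N θ χ p) (k + 1) s' = 0) :
    slotsOfRecord F N θ.ν θ.τ9 (EOfRecord₁₃Chi F N θ χ) (wOfRecord₉ F N θ.toStage9Params) θ.ppSel p (gOfRecord₁₃Chi F N θ χ p) (k + 1) s' = 0 := by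
  funext V
  rw [slotsOfRecord_succ]
  exact rstepSlotOfRecord_eq_zero_of_eq_zero θ.ν θ.τ9 θ.ppSel p _ (k + 1) _ s' h0 V

/-- **ON THE DEAD-MOVING BRANCH A DEAD SEQUENCE IS ABSENT FROM `ρ_{k+1}`**, Stage 13 — its post-𝐑 slot is the zero function, POINTWISE, NO proviso
(`rstepOfSel_TexpA_eq_zero_of_dead_of_idem`: at a dead fixed point every ratio numerator vanishes, a dead moved sequence is off the range of the idempotent selector).
[cite: Balaban1989LargeFieldI, (0.3) p.176, p.177 (i)–(ii); Balaban1988Convergent, (2.17)–(2.18) p.257, (3.24)–(3.25) p.270] -/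
theorem slotsOfRecord₁₃_succ_eq_zero_of_dead (k : ℕ)
    (hidem : ∀ a, θ.ppSel p (gOfRecord₁₃Chi F N θ χ p) (k + 1) (θ.ppSel p (gOfRecord₁₃Chi F N θ χ p) (k + 1) a) = θ.ppSel p (gOfRecord₁₃Chi F N θ χ p) (k + 1) a)
    (hdead : ∀ a, θ.ppSel p (gOfRecord₁₃Chi F N θ χ p) (k + 1) a ≠ a →
      ∀ V, B15.BasicStep.fibreIntegral (fibOfSeq F θ.ν θ.τ9 p (gOfRecord₁₃Chi F N θ χ p) (k + 1) a)
        (rterm (sliceOfRecord F N θ.ν θ.τ9.M p (gOfRecord₁₃Chi F N θ χ p) (k + 1)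
          (slotsTOfRecord F N θ.ν θ.τ9 (EOfRecord₁₃Chi F N θ χ) (wOfRecord₉ F N θ.toStage9Params) θ.ppSel p (gOfRecord₁₃Chi F N θ χ p) (k + 1))) a) V = 0)
    (s : SeqOfRecord F θ.ν θ.τ9.M (gOfRecord₁₃Chi F N θ χ p) p.K (k + 1))
    (hs : ∀ V, B15.BasicStep.fibreIntegral (fibOfSeq F θ.ν θ.τ9 p (gOfRecord₁₃Chi F N θ χ p) (k + 1) s)
        (rterm (sliceOfRecord F N θ.ν θ.τ9.M p (gOfRecord₁₃Chi F N θ χ p) (k + 1)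
          (slotsTOfRecord F N θ.ν θ.τ9 (EOfRecord₁₃Chi F N θ χ) (wOfRecord₉ F N θ.toStage9Params) θ.ppSel p (gOfRecord₁₃Chi F N θ χ p) (k + 1))) s) V = 0) :
    slotsOfRecord F N θ.ν θ.τ9 (EOfRecord₁₃Chi F N θ χ) (wOfRecord₉ F N θ.toStage9Params) θ.ppSel p (gOfRecord₁₃Chi F N θ χ p) (k + 1) s = 0 := by
  funext V
  rw [slotsOfRecord_succ, Pi.zero_apply]
  unfold rstepSlotOfRecord rstepSlot
  refine rstepOfSel_TexpA_eq_zero_of_dead_of_idem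
    (sliceOfRecord F N θ.ν θ.τ9.M p (gOfRecord₁₃Chi F N θ χ p) (k + 1)
      (slotsTOfRecord F N θ.ν θ.τ9 (EOfRecord₁₃Chi F N θ χ) (wOfRecord₉ F N θ.toStage9Params) θ.ppSel p (gOfRecord₁₃Chi F N θ χ p) (k + 1)))
    (θ.ppSel p (gOfRecord₁₃Chi F N θ χ p) (k + 1)) (fibOfSeq F θ.ν θ.τ9 p (gOfRecord₁₃Chi F N θ χ p) (k + 1)) hidem ?_ s ?_ V
  · intro a hne W
    have H := hdead a hne W
    convert H using 2
  · intro W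
    have H := hs W
    convert H using 2

end AtRecordSlots

/-! ## §2  ★ THE LEAF ON THE DEAD-MOVING (= live-selector) BRANCH, Stage 13: from the provisos, admissibility and the term-constant signs alone -/

section LiveBranch

variable (θ : Stage13Params F N) (χ : ChiSlot F N) (p : B12.RunParams)

end LiveBranch

/-! ## §3  ★ (S1ᵀ) IS NEEDED ONLY AT THE LIVE SEQUENCES: (S)-from-(T-live), and Theorem 1 [III] at the Stage-13 objects of record -/

section LiveOnly

variable (θ : Stage13Params F N) (χ : ChiSlot F N) (p : B12.RunParams)

end LiveOnly

/-! ## §4  THE N11∕N13 JUNCTION COMPOSED BY NAME at the Stage-13 record, dead-moving branch: `densitiesDescribed`, the node, the K1-shape, the (B)-face's first conjunct -/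

section Junction

variable (θ : Stage13Params F N) (χ : ChiSlot F N) (p : B12.RunParams) (w : WorldP) (h : θ.Provisos₁₃Chi F N χ)

end Junction

/-! ## §5  ★ 𝐑 OF RECORD IS THE IDENTITY ALMOST EVERYWHERE ON THE DEAD-MOVING BRANCH, Stage 13: `ρ_{k+1} = 𝐓ρ_k` a.e. under the integrable-form `rstep` -/

section IdentityAERecord

variable (θ : Stage13Params F N) (χ : ChiSlot F N) (p : B12.RunParams)

end IdentityAERecord

/-! ## §6  ★ AT THE LIVE SELECTOR CLAUSE `hsel : θ.ppSel = ppSelLiveOfRecord … (EOfRecord₁₃ θ) …` (node00-def-T's §4c binder; `rfl` at K0a's `θ.liveRepin₁₃` and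
`theta13LiveOfRecord`): idempotency and «moved ⇒ dead» DISCHARGED — the leaf from the provisos alone, (S1ᵀ) only at the live sequences, the node, the (B)-face
conjunct, 𝐑 = identity a.e. -/

section LiveSel

variable (θ : Stage13Params F N) (χ : ChiSlot F N)

/-- **THE LIVE SELECTOR OF RECORD IS IDEMPOTENT AT EVERY POSITIVE LEVEL** — read at a `θ` carrying the selector clause. [cite: Balaban1989LargeFieldI, (0.3) p.176, p.177 (`Z″″ = Z″`, bookkeeping)] -/
theorem ppSel_succ_idem_of_liveSel
    (hsel : θ.ppSel = ppSelLiveOfRecord F N θ.ν θ.τ9 (EOfRecord₁₃Chi F N θ χ) (wOfRecord₉ F N θ.toStage9Params)) (p : B12.RunParams) (k : ℕ)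
    (a : SeqOfRecord F θ.ν θ.τ9.M (gOfRecord₁₃Chi F N θ χ p) p.K (k + 1)) :
    θ.ppSel p (gOfRecord₁₃Chi F N θ χ p) (k + 1) (θ.ppSel p (gOfRecord₁₃Chi F N θ χ p) (k + 1) a) = θ.ppSel p (gOfRecord₁₃Chi F N θ χ p) (k + 1) a := by
  rw [hsel]
  exact ppSelLiveOfRecord_succ_idem θ.ν θ.τ9 (EOfRecord₁₃Chi F N θ χ) (wOfRecord₉ F N θ.toStage9Params) p (gOfRecord₁₃Chi F N θ χ p) k a

/-- **THE LIVE SELECTOR OF RECORD MOVES ONLY DEAD SEQUENCES of the pre-𝐑 family of record at the same level** — read at a `θ` carrying the selector clause.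
[cite: Balaban1989LargeFieldI, (0.3) p.176, p.177 (i)–(ii); Balaban1988Convergent, (3.24)–(3.25) p.270] -/
theorem dead_of_ppSel_succ_ne_of_liveSel
    (hsel : θ.ppSel = ppSelLiveOfRecord F N θ.ν θ.τ9 (EOfRecord₁₃Chi F N θ χ) (wOfRecord₉ F N θ.toStage9Params)) (p : B12.RunParams) (k : ℕ)
    (a : SeqOfRecord F θ.ν θ.τ9.M (gOfRecord₁₃Chi F N θ χ p) p.K (k + 1)) (hne : θ.ppSel p (gOfRecord₁₃Chi F N θ χ p) (k + 1) a ≠ a)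
    (V : GaugeField (F.P p.K) (k + 1) (SU N)) :
    B15.BasicStep.fibreIntegral (fibOfSeq F θ.ν θ.τ9 p (gOfRecord₁₃Chi F N θ χ p) (k + 1) a)
        (rterm (sliceOfRecord F N θ.ν θ.τ9.M p (gOfRecord₁₃Chi F N θ χ p) (k + 1)
          (slotsTOfRecord F N θ.ν θ.τ9 (EOfRecord₁₃Chi F N θ χ) (wOfRecord₉ F N θ.toStage9Params) θ.ppSel p (gOfRecord₁₃Chi F N θ χ p) (k + 1))) a) V = 0 := by
  revert hne
  rw [hsel]
  intro hne
  exact dead_of_ppSelLiveOfRecord_succ_ne θ.ν θ.τ9 (EOfRecord₁₃Chi F N θ χ) (wOfRecord₉ F N θ.toStage9Params) p (gOfRecord₁₃Chi F N θ χ p) k hne V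

variable (p : B12.RunParams)

variable (w : WorldP) (h : θ.Provisos₁₃Chi F N χ)

end LiveSel

/-! ## §7  (v1.1) THE GENERAL-SELECTOR SOCKET PER PRESENT SEQUENCE at Stage 13 ([IV] Prop. 1 + [B16] (1.100)–(1.101) at the objects of record; off-range by §1) -/

section Socket

variable (θ : Stage13Params F N) (χ : ChiSlot F N) (p : B12.RunParams)

end Socket

end Literature.MathematicalPhysics.QuantumFieldTheory.Balaban1983to89.B16RLeafRecord13LiveChi

end
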